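import Literature.Probability.Percolation.CornerPercolation
import Literature.Probability.Percolation.LatticeWalksGM
import HarnessLib

/-!
# Forced horizontal gate (stub `stub_gateTB`, line `Sketch`, crux `SegmentClosed`)

Route `CardySelfDualSegment` of `CriticalPhenomena/CardyFormulaZ2`, crux `SegmentClosed`
(stmt-CriticalPhenomena-5473). The deterministic "forced horizontal gate": a crude crossing
`embDomainCrossing squareLatticeEmbedding.z Ω δ A B` of a domain `Ω` at mesh `δ` by
nearest-neighbour edges of `ℤ²` (drawn by `squareLatticeEmbedding.z = √2 ·`), which must start
below the row `y₁` and end above the row `y₂` while the slab `y₁ ≤ im ≤ y₂` of `Ω` has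
`re ∈ [x₁, x₂]`, contains a top–bottom crossing `embTBCrossing` of the translate by
`w = x₁/δ + i √2 ⌈y₁/(√2 δ)⌉` of the lattice box `[0, a] × [0, b]` whenever
`0 ≤ b ≤ (y₂ - y₁)/δ - 4` and `(x₂ - x₁)/δ ≤ a`: clip the open connection between the lattice
rows `j₁ = ⌈y₁/(√2 δ)⌉` and `j₁ + ⌈b/√2⌉` (`exists_openConnIn_clip`).
-/

noncomputable section

open Set Filter Metric MeasureTheory Complex
open scoped Topology
open Literature.Probability.RandomPlanarGeometry Literature.Probability.Percolation
open Literature.Probability.LatticeModels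

namespace Summit.CriticalPhenomena.CardyFormulaZ2.Cruxes.SegmentClosed.Sketch

/-- Along an edge of `ℤ^d` every coordinate increases by at most one. -/
theorem gateTB_coord_le_of_adj {d : ℕ} (i : Fin d) (u v : Site d) (h : (zdGraph d).Adj u v) :
    v i ≤ u i + 1 := by
  rw [zdGraph_adj_iff] at h
  obtain ⟨j, hj | hj⟩ := h
  · rw [hj, Pi.add_apply, Pi.single_apply]
    split_ifs <;> omega
  · rw [hj, Pi.add_apply, Pi.single_apply]
    split_ifs <;> omega

/-- Real part of the rescaled drawing `δ · √2 · y` of a site `y` of `ℤ²`. -/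
theorem gateTB_smul_re (δ : ℝ) (y : Site 2) :
    ((δ : ℂ) * squareLatticeEmbedding.z y).re = δ * (Real.sqrt 2 * (y 0 : ℝ)) := by
  simp [squareLatticeEmbedding_z]

/-- Imaginary part of the rescaled drawing `δ · √2 · y` of a site `y` of `ℤ²`. -/
theorem gateTB_smul_im (δ : ℝ) (y : Site 2) :
    ((δ : ℂ) * squareLatticeEmbedding.z y).im = δ * (Real.sqrt 2 * (y 1 : ℝ)) := by
  simp [squareLatticeEmbedding_z]

/-- Real part of the translated drawing `√2 · y - (p + q i)` of a site `y` of `ℤ²`. -/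
theorem gateTB_sub_re (y : Site 2) (p q : ℝ) :
    (squareLatticeEmbedding.z y - ((p : ℂ) + (q : ℂ) * I)).re = Real.sqrt 2 * (y 0 : ℝ) - p := by
  simp [squareLatticeEmbedding_z]

/-- Imaginary part of the translated drawing `√2 · y - (p + q i)` of a site `y` of `ℤ²`. -/
theorem gateTB_sub_im (y : Site 2) (p q : ℝ) :
    (squareLatticeEmbedding.z y - ((p : ℂ) + (q : ℂ) * I)).im = Real.sqrt 2 * (y 1 : ℝ) - q := by
  simp [squareLatticeEmbedding_z]

/-- **Forced horizontal gate.** If every point of `Ω` within `2δ` of `A` has `im ≤ y₁`, every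
point of `Ω` within `2δ` of `B` has `im ≥ y₂`, and the part of `Ω` in the horizontal slab
`y₁ ≤ im ≤ y₂` has `re ∈ [x₁, x₂]`, then a crude crossing of `Ω` from `A` to `B` at mesh `δ` by
nearest-neighbour edges of `ℤ²` (drawn by `squareLatticeEmbedding.z = √2 ·`) contains a
top–bottom crossing of a translate of the lattice box `[0, a] × [0, b]` whenever
`0 ≤ b ≤ (y₂ - y₁)/δ - 4` and `a ≥ (x₂ - x₁)/δ`: clip the open connection at the lattice rows
`j₁ = ⌈y₁/(√2 δ)⌉` and `j₁ + ⌈b/√2⌉` (`exists_openConnIn_clip`). -/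
theorem stub_gateTB (Ω A B : Set ℂ) {δ x₁ x₂ y₁ y₂ a b : ℝ} (hδ : 0 < δ)
    (hA : ∀ p ∈ Ω, infDist p A ≤ 2 * δ → p.im ≤ y₁)
    (hB : ∀ p ∈ Ω, infDist p B ≤ 2 * δ → y₂ ≤ p.im)
    (hΩ : ∀ p ∈ Ω, y₁ ≤ p.im → p.im ≤ y₂ → x₁ ≤ p.re ∧ p.re ≤ x₂)
    (hb : 0 ≤ b) (hby : b ≤ (y₂ - y₁) / δ - 4) (ha : (x₂ - x₁) / δ ≤ a) :
    ∃ w : ℂ, ∀ ω : BondConfig (Site 2), ω ⊆ (zdGraph 2).edgeSet →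
      ω ∈ embDomainCrossing squareLatticeEmbedding.z Ω δ A B →
      ω ∈ embTBCrossing (fun v => squareLatticeEmbedding.z v - w) a b := by
  set s : ℝ := Real.sqrt 2 with hs_def
  have hs0 : 0 < s := Real.sqrt_pos.2 (by norm_num)
  have hss : s * s = 2 := Real.mul_self_sqrt (by norm_num)
  have hs2 : s < 2 := by nlinarith
  have hsδ : 0 < s * δ := mul_pos hs0 hδ
  set j₁ : ℤ := ⌈y₁ / (s * δ)⌉ with hj₁_def
  set k : ℤ := ⌈b / s⌉ with hk_def
  have hk0 : 0 ≤ k := Int.ceil_nonneg (div_nonneg hb hs0.le)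
  have hj₁le : y₁ / (s * δ) ≤ j₁ := Int.le_ceil _
  have hj₁lt : (j₁ : ℝ) < y₁ / (s * δ) + 1 := Int.ceil_lt_add_one _
  have hkle : b / s ≤ k := Int.le_ceil _
  have hklt : (k : ℝ) < b / s + 1 := Int.ceil_lt_add_one _
  -- the real-number bookkeeping
  have hy₁j : y₁ ≤ s * δ * j₁ := by
    have := (div_le_iff₀ hsδ).1 hj₁le
    linarith
  have hjy₁ : ((j₁ : ℝ) - 1) * (s * δ) < y₁ := (lt_div_iff₀ hsδ).1 (by linarith)
  have hbk : b ≤ s * k := by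
    have := (div_le_iff₀ hs0).1 hkle
    linarith
  have hkb : ((k : ℝ) - 1) * s < b := (lt_div_iff₀ hs0).1 (by linarith)
  have hkbδ : δ * (((k : ℝ) - 1) * s) < δ * b := mul_lt_mul_of_pos_left hkb hδ
  have hbyδ : (b + 4) * δ ≤ y₂ - y₁ := (le_div_iff₀ hδ).1 (by linarith)
  have hs2δ : s * δ < 2 * δ := mul_lt_mul_of_pos_right hs2 hδ
  have htop : s * δ * ((j₁ : ℝ) + k) < y₂ := by linarith
  refine ⟨((x₁ / δ : ℝ) : ℂ) + ((s * j₁ : ℝ) : ℂ) * I, ?_⟩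
  intro ω hωE hcross
  obtain ⟨u, hu, v, hv, hconn⟩ := hcross
  obtain ⟨huS, hvS, -⟩ := id hconn
  have huΩ : (δ : ℂ) * squareLatticeEmbedding.z u ∈ Ω := huS
  have hvΩ : (δ : ℂ) * squareLatticeEmbedding.z v ∈ Ω := hvS
  -- the start is below row `j₁`, the end above row `j₁ + k`
  have hu1 : s * δ * (u 1 : ℝ) ≤ y₁ := by
    have h := hA _ huΩ hu
    rw [gateTB_smul_im] at h
    linarith
  have hv1 : y₂ ≤ s * δ * (v 1 : ℝ) := by
    have h := hB _ hvΩ hv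
    rw [gateTB_smul_im] at h
    linarith
  have hxu : u 1 ≤ j₁ := by
    have h : ((u 1 : ℤ) : ℝ) ≤ j₁ := by
      have h' : ((u 1 : ℤ) : ℝ) ≤ y₁ / (s * δ) := by
        rw [le_div_iff₀ hsδ]
        linarith
      linarith
    exact_mod_cast h
  have hyv : j₁ + k ≤ v 1 := by
    have h : ((j₁ + k : ℤ) : ℝ) < ((v 1 : ℤ) : ℝ) := by
      push_cast
      exact lt_of_mul_lt_mul_left (by linarith) hsδ.le
    exact (Int.cast_lt.1 h).le
  -- clip the open connection to the rows `j₁ ≤ · ≤ j₁ + k`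
  obtain ⟨x', y', hx', hy', hconn'⟩ :=
    exists_openConnIn_clip hωE (fun z : Site 2 => z 1)
      (fun p q hpq => gateTB_coord_le_of_adj 1 p q hpq) (show j₁ ≤ j₁ + k by omega) hxu hyv hconn
  refine ⟨x', ?_, y', ?_, openConnIn_mono ?_ x' y' hconn'⟩
  · -- the start lies on the bottom row of the box
    show (squareLatticeEmbedding.z x' - (((x₁ / δ : ℝ) : ℂ) + ((s * j₁ : ℝ) : ℂ) * I)).im ≤ 0
    rw [gateTB_sub_im]
    have h : ((x' 1 : ℤ) : ℝ) = j₁ := by exact_mod_cast hx'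
    rw [h]
    linarith
  · -- the end lies on or above the top row of the box
    show b ≤ (squareLatticeEmbedding.z y' - (((x₁ / δ : ℝ) : ℂ) + ((s * j₁ : ℝ) : ℂ) * I)).im
    rw [gateTB_sub_im]
    have h : ((y' 1 : ℤ) : ℝ) = j₁ + k := by exact_mod_cast hy'
    rw [h]
    linarith
  · -- clipped vertices lie in the box `[0, a] × [-2, b + 2]`
    rintro y ⟨hyS, hy1, hy2⟩
    have hyΩ : (δ : ℂ) * squareLatticeEmbedding.z y ∈ Ω := hyS
    have hy1' : (j₁ : ℝ) ≤ ((y 1 : ℤ) : ℝ) := by exact_mod_cast hy1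
    have hy2' : ((y 1 : ℤ) : ℝ) ≤ (j₁ : ℝ) + k := by exact_mod_cast hy2
    have hlo' : s * δ * (j₁ : ℝ) ≤ s * δ * ((y 1 : ℤ) : ℝ) := mul_le_mul_of_nonneg_left hy1' hsδ.le
    have hhi' : s * δ * ((y 1 : ℤ) : ℝ) ≤ s * δ * ((j₁ : ℝ) + k) :=
      mul_le_mul_of_nonneg_left hy2' hsδ.le
    have hlo : y₁ ≤ ((δ : ℂ) * squareLatticeEmbedding.z y).im := by
      rw [gateTB_smul_im]
      linarith
    have hhi : ((δ : ℂ) * squareLatticeEmbedding.z y).im ≤ y₂ := by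
      rw [gateTB_smul_im]
      linarith
    obtain ⟨hx₁, hx₂⟩ := hΩ _ hyΩ hlo hhi
    rw [gateTB_smul_re] at hx₁ hx₂
    show (squareLatticeEmbedding.z y - (((x₁ / δ : ℝ) : ℂ) + ((s * j₁ : ℝ) : ℂ) * I)).re ∈ Icc 0 a ∧
      (squareLatticeEmbedding.z y - (((x₁ / δ : ℝ) : ℂ) + ((s * j₁ : ℝ) : ℂ) * I)).im ∈ Icc (-2) (b + 2)
    rw [gateTB_sub_re, gateTB_sub_im, Set.mem_Icc, Set.mem_Icc]
    have hre0 : x₁ / δ ≤ s * ((y 0 : ℤ) : ℝ) := by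
      rw [div_le_iff₀ hδ]
      linarith
    have hre1 : s * ((y 0 : ℤ) : ℝ) - x₁ / δ ≤ (x₂ - x₁) / δ := by
      rw [sub_div, sub_le_sub_iff_right, le_div_iff₀ hδ]
      linarith
    have him1 : s * ((y 1 : ℤ) : ℝ) ≤ s * ((j₁ : ℝ) + k) := mul_le_mul_of_nonneg_left hy2' hs0.le
    have him0 : s * (j₁ : ℝ) ≤ s * ((y 1 : ℤ) : ℝ) := mul_le_mul_of_nonneg_left hy1' hs0.le
    refine ⟨⟨by linarith, by linarith⟩, by linarith, by nlinarith⟩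

end Summit.CriticalPhenomena.CardyFormulaZ2.Cruxes.SegmentClosed.Sketch
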